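import Mathlib
import HarnessLib
import Summits.Ventures.LatticeQCDFlow.Scaling.AutoregressiveSiteProposalAcceptanceFloor
import Summits.Ventures.LatticeQCDFlow.Scaling.AutoregressiveProposalKLPinsker

/-!
# LatticeQCDFlow / Scaling — the LEARNED HEAT BATH certifies itself through its training loss: a
# Metropolised single-coordinate update whose proposal has mean conditional divergence `κ` from the exact
# one-coordinate conditional accepts at rate `≥ (1 − √(κ/2))²`

HONEST FRAMING: exact (Metropolis-corrected) sampling algorithms for lattice gauge theory;
figures of merit are autocorrelation/cost numbers at stated couplings and volumes; no
continuum-physics claim.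

Venture `LatticeQCDFlow` (cell pub-lqcd), topic `Scaling`, FANOUT row 30 (lean-1, GEN-20) — OUR WORK on
THEORY-2.md §4 row C5, the training-loss form of gen-19's learned-heat-bath files
(`Scaling/AutoregressiveSiteProposalAcceptance{,Floor}`: `m² ≤ ā_a ≤ m`,
`m = Z⁻¹∫min(F, A_aF·q) = 1 − (1/(2Z))∫|F − A_aF·q|`), via `Scaling/AutoregressiveProposalKLPinsker`
(Pinsker for one step, here the step `s = ∅`: `(∫|F − q·A_aF|)² ≤ 2Z·∫F log(F/(q·A_aF))`).

## Setting

`π = ⊗_ι μ`; target weight `F` measurable with `0 < c_F ≤ F ≤ C_F`, `Z = ∫F dπ`; a coordinate `a`; a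
learned proposal `q` for `ω_a` given the rest (measurable, `0 < c_q ≤ q ≤ C_q`, normalised in `a`).  The
exact one-coordinate conditional is `F/A_aF`; the MEAN CONDITIONAL DIVERGENCE (the population training
loss of `q` less the entropy constant) is `κ = Z⁻¹∫F·log(F/(q·A_aF)) dπ ≥ 0`; the sampler is the
Metropolised single-coordinate update (propose `v ∼ q(·|rest)`, accept with the Metropolis–Hastings
ratio), exact by construction; `ā_a = Z⁻¹∫∫∫min(F(U[a↦v])q(U[a↦v']), F(U[a↦v'])q(U[a↦v])) dμ dμ dπ` its
equilibrium acceptance.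

## What is proved (all [ours]; assembled)

* **`siteOverlap_ge_one_sub_sqrt_half_kl`** — `m ≥ 1 − √(κ/2)`.
* **`siteMeanAccept_ge_sq_one_sub_sqrt_half_kl`** — if `κ ≤ 2` then `(1 − √(κ/2))² ≤ ā_a`.

READING (value-free): for the exact-by-construction algorithm class used for groups without a heat bath
(learned single-link proposals, Metropolis-corrected), the per-link training loss `κ` alone certifies an
equilibrium acceptance `≥ (1 − √(κ/2))²` — `κ = 0.02` nats gives `≥ 0.81`, `κ = 0.08` gives `≥ 0.64` —
model-free, every target, every volume.  NOT CLAIMED: anything about autocorrelations of the resulting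
single-site sweep; the reverse divergence.  No `def`, no `sorry`, nothing cited as a fact.
-/

noncomputable section

namespace Summit.Ventures.LatticeQCDFlow.Theory2.Autoregressive

open MeasureTheory Function Set
open Summit.Ventures.LatticeQCDFlow.Exactness

variable {ι : Type*} [Fintype ι] [DecidableEq ι] {X : Type*} [MeasurableSpace X]
variable (μ : Measure X) [IsProbabilityMeasure μ]

variable {a : ι} {F q : (ι → X) → ℝ}

/-- **`m ≥ 1 − √(κ/2)`**: the overlap `Z⁻¹∫min(F, A_aF·q) dπ` of the learned heat bath is at least
`1 − √(κ/2)`, `κ = Z⁻¹∫F·log(F/(q·A_aF)) dπ` the mean conditional divergence. [ours] -/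
theorem siteOverlap_ge_one_sub_sqrt_half_kl (hFm : Measurable F) {cF CF : ℝ} (hcF : 0 < cF)
    (hFlo : ∀ U, cF ≤ F U) (hFhi : ∀ U, F U ≤ CF)
    (hqm : Measurable q) {cq Cq : ℝ} (hcq : 0 < cq) (hqlo : ∀ U, cq ≤ q U) (hqhi : ∀ U, q U ≤ Cq)
    (hq1 : ∀ U, ∫ v, q (update U a v) ∂μ = 1) :
    1 - Real.sqrt ((∫ U, F U * Real.log (F U / (q U * coordAvg μ {a} F U)) ∂Measure.pi (fun _ : ι => μ)) /
        (∫ U, F U ∂Measure.pi (fun _ : ι => μ)) / 2) ≤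
      (∫ U, min (F U) (coordAvg μ {a} F U * q U) ∂Measure.pi (fun _ : ι => μ)) /
        ∫ U, F U ∂Measure.pi (fun _ : ι => μ) := by
  set Z : ℝ := ∫ U, F U ∂Measure.pi (fun _ : ι => μ) with hZdef
  set K : ℝ := ∫ U, F U * Real.log (F U / (q U * coordAvg μ {a} F U)) ∂Measure.pi (fun _ : ι => μ) with hK
  set D : ℝ := ∫ U, |F U - coordAvg μ {a} F U * q U| ∂Measure.pi (fun _ : ι => μ) with hD
  have hF0 : ∀ U, 0 ≤ F U := fun U => hcF.le.trans (hFlo U)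
  have hFabs : ∀ U, |F U| ≤ CF := fun U => by rw [abs_of_nonneg (hF0 U)]; exact hFhi U
  have hq0 : ∀ U, 0 ≤ q U := fun U => hcq.le.trans (hqlo U)
  have hZpos : 0 < Z := by
    have h1 : ∫ _, cF ∂Measure.pi (fun _ : ι => μ) ≤ Z :=
      integral_mono (integrable_const cF) (integrable_pi_of_abs_le μ hFm hFabs) hFlo
    have h2 : ∫ _, cF ∂Measure.pi (fun _ : ι => μ) = cF := by
      rw [integral_const, smul_eq_mul, Measure.real, measure_univ, ENNReal.toReal_one, one_mul]
    linarith
  -- Scheffé form of the overlap (gen-19)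
  rw [siteOverlap_eq_one_sub_half_integral_abs μ hFm hF0 hFhi hZpos hqm hq0 hqhi hq1]
  -- Pinsker for the step `s = ∅` (this generation)
  have hpin := sq_integral_abs_condGap_le μ (∅ : Finset ι) (Finset.notMem_empty a) hFm hcF hFlo hFhi hqm
    hcq hqlo hqhi hq1 (fun U U' => by simp)
  simp only [coordAvg_empty, Finset.insert_empty] at hpin
  have hD' : ∫ U, |F U - q U * coordAvg μ {a} F U| ∂Measure.pi (fun _ : ι => μ) = D := by
    rw [hD]
    refine integral_congr_ae (ae_of_all _ fun U => ?_)
    dsimp only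
    rw [mul_comm (q U)]
  rw [hD'] at hpin
  -- `D² ≤ 2 Z K` ⇒ `D/(2Z) ≤ √(K/Z/2)`
  have hD0 : 0 ≤ D := integral_nonneg fun U => abs_nonneg _
  have hK0 : 0 ≤ K := by nlinarith [sq_nonneg D, hZpos]
  have hkey : D / (2 * Z) ≤ Real.sqrt (K / Z / 2) := by
    rw [← Real.sqrt_sq (by positivity : 0 ≤ D / (2 * Z))]
    apply Real.sqrt_le_sqrt
    calc (D / (2 * Z)) ^ 2 = D ^ 2 / (4 * Z ^ 2) := by ring
      _ ≤ 2 * Z * K / (4 * Z ^ 2) := div_le_div_of_nonneg_right hpin (by positivity)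
      _ = K / Z / 2 := by field_simp; ring
  linarith

/-- **THE TRAINING LOSS CERTIFIES THE ACCEPTANCE: `(1 − √(κ/2))² ≤ ā_a`** whenever `κ ≤ 2`, for the
Metropolised single-coordinate update with learned proposal `q` (gen-19's floor `m² ≤ ā_a` and
`siteOverlap_ge_one_sub_sqrt_half_kl`). [ours] -/
theorem siteMeanAccept_ge_sq_one_sub_sqrt_half_kl (hFm : Measurable F) {cF CF : ℝ} (hcF : 0 < cF)
    (hFlo : ∀ U, cF ≤ F U) (hFhi : ∀ U, F U ≤ CF)
    (hqm : Measurable q) {cq Cq : ℝ} (hcq : 0 < cq) (hqlo : ∀ U, cq ≤ q U) (hqhi : ∀ U, q U ≤ Cq)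
    (hq1 : ∀ U, ∫ v, q (update U a v) ∂μ = 1)
    (hκ : (∫ U, F U * Real.log (F U / (q U * coordAvg μ {a} F U)) ∂Measure.pi (fun _ : ι => μ)) /
        (∫ U, F U ∂Measure.pi (fun _ : ι => μ)) ≤ 2) :
    (1 - Real.sqrt ((∫ U, F U * Real.log (F U / (q U * coordAvg μ {a} F U)) ∂Measure.pi (fun _ : ι => μ)) /
        (∫ U, F U ∂Measure.pi (fun _ : ι => μ)) / 2)) ^ 2 ≤
      (∫ U, ∫ v, ∫ v', min (F (update U a v) * q (update U a v')) (F (update U a v') * q (update U a v)) ∂μ ∂μ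
        ∂Measure.pi (fun _ : ι => μ)) / ∫ U, F U ∂Measure.pi (fun _ : ι => μ) := by
  have hq0 : ∀ U, 0 ≤ q U := fun U => hcq.le.trans (hqlo U)
  have hm := siteOverlap_ge_one_sub_sqrt_half_kl μ hFm hcF hFlo hFhi hqm hcq hqlo hqhi hq1
  have hfloor := sq_overlap_le_siteMeanAccept μ hFm hcF hFlo hFhi hqm hq0 hqhi hq1
  -- `0 ≤ 1 − √(κ/2)` since `κ ≤ 2`
  have h0 : 0 ≤ 1 - Real.sqrt ((∫ U, F U * Real.log (F U / (q U * coordAvg μ {a} F U))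
      ∂Measure.pi (fun _ : ι => μ)) / (∫ U, F U ∂Measure.pi (fun _ : ι => μ)) / 2) := by
    rw [sub_nonneg, show (1 : ℝ) = Real.sqrt 1 from Real.sqrt_one.symm]
    exact Real.sqrt_le_sqrt (by linarith)
  exact (pow_le_pow_left₀ h0 hm 2).trans hfloor

end Summit.Ventures.LatticeQCDFlow.Theory2.Autoregressive

end
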